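import Summits.QuantumFields.YangMills.Theorems.FluctuationComparisonRegPrIntLS2BetaChartReadConstFlat
import Literature.MathematicalPhysics.QuantumFieldTheory.Balaban1983to89.MatrixLogLipschitz
import Literature.Analysis.Complex.RungeUnits
import Summits.QuantumFields.BalabanUV.T4Continuum.Spine.NE7.QLaBlockAvgLinear
import HarnessLib

/-!
# S2β · (β-3)′ FILE C₁ — THE BACKGROUND LETTERS OF THE CHART READ: step factors, walk products and the (0.4) average of a background `U₀` with `‖U₀(b) − 1‖ ≤ κ` on the bonds
# issuing from `B(c₋) ∪ B(c₊)` are within `e^{‖A‖}κ` ∕ `2ℓκ` ∕ `26ℓκ` of their FLAT (`U₀ = 1`) counterparts — the inputs of FILE C₂ `…ChartReadBkgLipschitz` («the second variation of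
# `ψ_{U₀}` is Lipschitz in the background», the curvature half `q′·M²·κ(U₀)` of (β-3)′)

Cell `ym3-torus` (YM ladder rung R3 = continuum `SU(2)` Yang–Mills on the three-torus at fixed lattice data — a RUNG: NOT d = 4, NOT infinite volume, NOT a mass gap,
NOT Clay).  Width seat `ym3-torus-px13` (gen 28); crux `stmt-QuantumFields-20520`, LINE g18-1 S2β, pairing lane; (SCT″-c)₁ source budget (S-SRC) ∕ (β-3)′ (ARCHITECT RULING px17 g22
2026-08-31T19:55:50Z «(β-3)′ YES — px13's pen»: the order-2 chart remainder in OSCILLATION + BACKGROUND-CURVATURE form `q·M·OSC + q′·M²·κ(U₀) + q₃M³`, the cure of HAZARD «SRC-q (2)»).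
`--kind proof --supports stmt-QuantumFields-20520 --as helper`, count-neutral, DEFINITION-FREE (0 `def`, 0 `instance`, 0 `notation`, 0 `sorry`, default heartbeats); generic `P : Params`,
`SU(N)`, the N09 ∕ (D1) ∕ (β-1)–(β-4) chart-read conventions (the complexified objects written out as terms, as in (β-1)).

THE ROAD (print's, [Balaban1985Averaging] Prop. 3 p.36: complexify in `A`, then Cauchy).  With `σ^{U₀}_A(s) = e^{A_b}U₀(b)` ∕ `U₀(b)⋆e^{−A_b}` the complexified step factors of (β-1),
`σ^{U₀}_A(s) − σ^{1}_A(s) = e^{A_b}(U₀(b) − 1)` ∕ `(U₀(b) − 1)⋆e^{−A_b}`, so for a word `γ` of length `≤ ℓ = (d+2)L` whose bonds carry `‖U₀(b) − 1‖ ≤ κ`, telescoping gives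
`‖W^{U₀}_A(γ) − W^{1}_A(γ)‖ ≤ |γ|·e^{‖A‖}κ·e^{|γ|‖A‖} ≤ 2ℓκ` on the polydisc `100ℓ(e^{‖A‖} − 1) ≤ ρ ≤ 1∕3`, and `‖U₀(γ) − 1‖ ≤ (1 + κ)^{|γ|} − 1 ≤ 2ℓκ` (`100ℓκ ≤ ρ`); the bonds of every
(0.4) word at `c` issue from `B(c₋) ∪ B(c₊)` (lit ✓`blockOf_src_of_mem_walk`, NE7 ✓`blockOf_src_of_mem_axWalk` for the straight segment), so the LOCAL hypothesis suffices, the loop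
guard `dist1 (loopHol U₀ c i) ≤ 2ℓκ` follows, and `↑Ū(U₀)(c) = eml(loops)·(segment)` (lit ✓`coe_avgFun_of_small`) is within `12·2ℓκ + 2ℓκ = 26ℓκ` of `Ū(1)(c) = 1` (`eml` `12`-Lipschitz at `1`).

WHAT IS PROVED (sorry-free).
* §1 generic (normed ring, `‖1‖ = 1`): `norm_list_map_prod_le_pow` (`‖∏f‖ ≤ K^{|l|}`), ★`norm_list_map_prod_sub_prod_le` (`‖∏f − ∏g‖ ≤ |l|·δ·K^{|l|}`, factors `≤ K`, `1 ≤ K`, pairwise `δ`-close),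
  `norm_list_map_prod_sub_one_le` (`≤ (1+κ)^{|l|} − 1`).
* §2 steps: `norm_stepC_le` (`≤ e^{‖A‖}`), ★`norm_stepC_sub_stepC_one_le` (`≤ e^{‖A‖}·κ`), `norm_stepM_sub_one_le` (`≤ κ`).
* §3 walks: ★`norm_holC_sub_holC_one_le` (telescoped form), `exp_pow_succ_le_two`, ★★`norm_holC_sub_holC_one_le_two_mul` (`≤ 2ℓκ` on the polydisc), ★`norm_holM_sub_one_le` (`‖U₀(γ) − 1‖ ≤ 2ℓκ`).
* §4 at `c` (standing range `j + 1 ≤ m + K`, LOCAL hypothesis `hκ : ∀ b, blockOf b.src ∈ {c₋, c₊} → ‖U₀(b) − 1‖ ≤ κ`, `100ℓκ ≤ ρ`): `kappa_nonneg_of_local`,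
  ★`dist1_loopHol_le_of_local` (the guard `≤ 2ℓκ`), ★★`norm_coe_avgFun_sub_one_le` (**`‖↑Ū(U₀)(c) − 1‖ ≤ 26·ℓ·κ`**).

HONEST.  Elementary telescoping ∕ Lipschitz bookkeeping over LANDED lit engines (`Node00.AveragingSmooth`, `BlockAveragingEMLAnalyticMean`, `MatrixLogLipschitz`, `B7TransferAnalyticMean`,
`T3DescentFibreTower`) and the (β-1)∕(β-2)∕(β-3) chart-read files; NO estimate of Bałaban's renormalisation analysis is asserted or proved ([Balaban1985Averaging] (19)–(21), Prop. 3
(121)–(125), Prop. 4 (148)–(149) and [Balaban1987RG1] (0.3)–(0.4) are cited as the SOURCES of the objects and of the shape of the estimate); the axial-gauge letter «`PlaqSmall δ` + loop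
guard `α` ⟹ a gauge copy of `U₀` with `‖U₀(b) − 1‖ ≤ C(Lδ + α)` on `B(c₋) ∪ B(c₊)`», the gauge covariance of `ψ`, the OSC-lift letter, (RSP-Σ), (BKG), rows v2, (ST‴), (SCT″-c)₁₂₃, LOC‴,
GAP♯∘ (`stub_uniformFibreGapOrbit`, registry 3732b7df UNTOUCHED, 0∕5), the five REGISTERED stubs, S2β, crux 20520, 19936, 19200, `YM3TorusSU2` — NOT proved; no summit statement is proved by
a helper; rung R3 = SU(2) YM₃ on T³ at fixed lattice data — NOT d = 4, NOT infinite volume, NOT a mass gap, NOT Clay; the Yang–Mills mass gap is NOT proved.  Axioms standard.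

References: [Balaban1985Averaging] T. Bałaban, CMP **98** (1985) 17–51, (15) p.19, (19)–(21) p.21, Prop. 3 (121)–(125) p.36, Prop. 4 (148)–(149) p.40; [Balaban1987RG1] CMP **109** (1987)
249–301, (0.3)–(0.4), (0.8) pp.252–253; [Balaban1985BackgroundPropagators] CMP **99** (1985) 389–434, (3.6) p.391.
-/

set_option autoImplicit false

noncomputable section

open scoped Matrix.Norms.L2Operator Topology
open Filter Set Function Metric

namespace Summit.QuantumFields.YangMills.Theorems.FluctuationComparisonRegPrIntLS2BetaChartReadBkgLetters

open Literature.MathematicalPhysics.QuantumFieldTheory.Balaban1983to89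
open Literature.MathematicalPhysics.QuantumFieldTheory.Balaban1983to89.HaarExponentialChart
open Literature.MathematicalPhysics.QuantumFieldTheory.Balaban1983to89.HaarExponentialChart.IsChartRep
open Literature.MathematicalPhysics.QuantumFieldTheory.Balaban1983to89.BlockAveraging (Small Idx avgFun loopHol off corr blockOf_src_of_mem_walk)
open Literature.MathematicalPhysics.QuantumFieldTheory.Balaban1983to89.ExpMeanLog (eml expMeanLogSU deltaSU deltaSU_pos)
open Literature.MathematicalPhysics.QuantumFieldTheory.Balaban1983to89.Node00
open Literature.MathematicalPhysics.QuantumFieldTheory.Balaban1983to89.T4Continuum (walk holAt LStep loopWord)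
open Literature.MathematicalPhysics.QuantumFieldTheory.Balaban1983to89.BlockAveragingEMLLinearised (length_walk length_walk_replicate_le)
open Literature.MathematicalPhysics.QuantumFieldTheory.Balaban1983to89.LatticeWordStokes (length_loopWord_le)
open Literature.MathematicalPhysics.QuantumFieldTheory.Balaban1983to89.BlockAveragingEMLAnalyticMean (eml_one norm_eml_add_sub_eml_le)
open MatrixLog (mlog mlog_one)
open Summit.QuantumFields.YangMills.BalabanUVNodes.N09ChartReadAveragingSmooth
open Summit.QuantumFields.YangMills.BalabanUVNodes.N09CentralWindowInjective (norm_coe_SU_le_one)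
open Summit.QuantumFields.YangMills.Theorems.FluctuationComparisonRegPrIntLS2BetaChartReadCplxExtension
open Summit.QuantumFields.YangMills.Theorems.FluctuationComparisonRegPrIntLS2BetaChartReadCplxAnalytic
open Summit.QuantumFields.BalabanUV.T4Continuum.Spine.NE7 (blockOf_src_of_mem_axWalk)

/-! ## §1 Generic: two products whose factors are pairwise `δ`-close and bounded by `K ≥ 1` differ by at most `|l|·δ·K^{|l|}` -/

section Generic

variable {σ : Type*} {𝔸 : Type*} [NormedRing 𝔸] [NormOneClass 𝔸]

/-- A product of factors of norm `≤ K` (`0 ≤ K`) has norm `≤ K^{|l|}`. [folklore] -/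
theorem norm_list_map_prod_le_pow (l : List σ) (f : σ → 𝔸) {K : ℝ} (hK0 : 0 ≤ K) (hf : ∀ s ∈ l, ‖f s‖ ≤ K) :
    ‖(l.map f).prod‖ ≤ K ^ l.length := by
  induction l with
  | nil => simp
  | cons s l ih =>
    rw [List.map_cons, List.prod_cons, List.length_cons, pow_succ']
    exact (norm_mul_le _ _).trans (mul_le_mul (hf s (by simp)) (ih fun t ht => hf t (by simp [ht])) (norm_nonneg _) hK0)

/-- **Telescoping**: if the factors of `f` and `g` have norm `≤ K` (`1 ≤ K`) and are pairwise within `δ`, then `‖∏ f − ∏ g‖ ≤ |l|·δ·K^{|l|}`. [folklore] -/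
theorem norm_list_map_prod_sub_prod_le (l : List σ) (f g : σ → 𝔸) {K δ : ℝ} (hK1 : 1 ≤ K) (hδ : 0 ≤ δ)
    (hf : ∀ s ∈ l, ‖f s‖ ≤ K) (hg : ∀ s ∈ l, ‖g s‖ ≤ K) (hfg : ∀ s ∈ l, ‖f s - g s‖ ≤ δ) :
    ‖(l.map f).prod - (l.map g).prod‖ ≤ (l.length : ℝ) * δ * K ^ l.length := by
  have hK0 : 0 ≤ K := zero_le_one.trans hK1
  induction l with
  | nil => simp
  | cons s l ih =>
    rw [List.map_cons, List.map_cons, List.prod_cons, List.prod_cons, List.length_cons]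
    have hfs : ‖f s‖ ≤ K := hf s (by simp)
    have hgs : ‖g s‖ ≤ K := hg s (by simp)
    have hds : ‖f s - g s‖ ≤ δ := hfg s (by simp)
    have ih' : ‖(l.map f).prod - (l.map g).prod‖ ≤ (l.length : ℝ) * δ * K ^ l.length :=
      ih (fun t ht => hf t (by simp [ht])) (fun t ht => hg t (by simp [ht])) (fun t ht => hfg t (by simp [ht]))
    have hPf : ‖(l.map f).prod‖ ≤ K ^ l.length := norm_list_map_prod_le_pow l f hK0 fun t ht => hf t (by simp [ht])
    have hsplit : f s * (l.map f).prod - g s * (l.map g).prod = (f s - g s) * (l.map f).prod + g s * ((l.map f).prod - (l.map g).prod) := by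
      noncomm_ring
    rw [hsplit]
    have hKn : 0 ≤ K ^ l.length := pow_nonneg hK0 _
    have hKsucc : K ^ l.length ≤ K ^ (l.length + 1) := by rw [pow_succ]; exact le_mul_of_one_le_right hKn hK1
    calc ‖(f s - g s) * (l.map f).prod + g s * ((l.map f).prod - (l.map g).prod)‖
        ≤ ‖f s - g s‖ * ‖(l.map f).prod‖ + ‖g s‖ * ‖(l.map f).prod - (l.map g).prod‖ :=
          (norm_add_le _ _).trans (add_le_add (norm_mul_le _ _) (norm_mul_le _ _))
      _ ≤ δ * K ^ l.length + K * ((l.length : ℝ) * δ * K ^ l.length) :=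
          add_le_add (mul_le_mul hds hPf (norm_nonneg _) hδ) (mul_le_mul hgs ih' (norm_nonneg _) hK0)
      _ ≤ δ * K ^ (l.length + 1) + K * ((l.length : ℝ) * δ * K ^ l.length) := by gcongr
      _ = (((l.length + 1 : ℕ) : ℝ)) * δ * K ^ (l.length + 1) := by rw [pow_succ]; push_cast; ring

/-- A product of factors each within `κ` of `1` is within `(1 + κ)^{|l|} − 1` of `1`. [folklore] -/
theorem norm_list_map_prod_sub_one_le (l : List σ) (f : σ → 𝔸) {κ : ℝ} (hκ0 : 0 ≤ κ) (hf : ∀ s ∈ l, ‖f s - 1‖ ≤ κ) :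
    ‖(l.map f).prod - 1‖ ≤ (1 + κ) ^ l.length - 1 := by
  have h := norm_list_map_prod_sub_le l f (fun _ => (1 : 𝔸)) hκ0 (fun s hs => hf s hs) (fun _ _ => by rw [norm_one])
  have h1 : (l.map (fun _ : σ => (1 : 𝔸))).prod = 1 := by simp
  rwa [h1] at h

end Generic

/-! ## §2 One step: the complexified step factors at `U₀` and at `1` differ by `e^{‖A‖}·‖U₀(b) − 1‖`; both have norm `≤ e^{‖A‖}`; the background step is within `‖U₀(b) − 1‖` of `1` -/

section Steps

variable {P : Params} {j : ℕ} {N : ℕ} [NeZero N] (U₀ : GaugeField P j (SU N))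

/-- The complexified step factor has norm `≤ e^{‖A‖}` (unitary background factor of norm `≤ 1`). [cite: Balaban1985Averaging, (19) p.21 (bookkeeping)] -/
theorem norm_stepC_le (s : LStep P j) (A : PBond P j → Matrix (Fin N) (Fin N) ℂ) :
    ‖(if s.fwd then NormedSpace.exp (A s.bond) * ((U₀ s.bond : SU N) : Matrix (Fin N) (Fin N) ℂ)
      else star ((U₀ s.bond : SU N) : Matrix (Fin N) (Fin N) ℂ) * NormedSpace.exp (-(A s.bond)))‖ ≤ Real.exp ‖A‖ := by
  have hb : Real.exp ‖A s.bond‖ ≤ Real.exp ‖A‖ := Real.exp_le_exp.2 (norm_le_pi_norm A s.bond)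
  have hU : ‖((U₀ s.bond : SU N) : Matrix (Fin N) (Fin N) ℂ)‖ ≤ 1 := norm_coe_SU_le_one _
  have he0 : 0 ≤ Real.exp ‖A s.bond‖ := (Real.exp_pos _).le
  split_ifs
  · calc _ ≤ ‖NormedSpace.exp (A s.bond)‖ * ‖((U₀ s.bond : SU N) : Matrix (Fin N) (Fin N) ℂ)‖ := norm_mul_le _ _
      _ ≤ Real.exp ‖A s.bond‖ * 1 := mul_le_mul (Literature.Analysis.Complex.norm_exp_le_exp_norm _) hU (norm_nonneg _) he0
      _ ≤ Real.exp ‖A‖ := by rw [mul_one]; exact hb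
  · calc _ ≤ ‖star ((U₀ s.bond : SU N) : Matrix (Fin N) (Fin N) ℂ)‖ * ‖NormedSpace.exp (-(A s.bond))‖ := norm_mul_le _ _
      _ ≤ 1 * Real.exp ‖A s.bond‖ := by
          refine mul_le_mul (by rw [norm_star]; exact hU) ?_ (norm_nonneg _) zero_le_one
          have h := Literature.Analysis.Complex.norm_exp_le_exp_norm (-(A s.bond)); rwa [norm_neg] at h
      _ ≤ Real.exp ‖A‖ := by rw [one_mul]; exact hb

/-- **THE STEP FACTORS AT `U₀` AND AT `1` DIFFER BY `e^{‖A‖}·‖U₀(b) − 1‖**: `e^{A_b}U₀(b) − e^{A_b} = e^{A_b}(U₀(b) − 1)`, `U₀(b)⋆e^{−A_b} − e^{−A_b} = (U₀(b) − 1)⋆e^{−A_b}`.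
[cite: Balaban1985Averaging, (19)-(20) p.21 (bookkeeping)] -/
theorem norm_stepC_sub_stepC_one_le (s : LStep P j) (A : PBond P j → Matrix (Fin N) (Fin N) ℂ) {κ : ℝ}
    (hκ : ‖((U₀ s.bond : SU N) : Matrix (Fin N) (Fin N) ℂ) - 1‖ ≤ κ) :
    ‖(if s.fwd then NormedSpace.exp (A s.bond) * ((U₀ s.bond : SU N) : Matrix (Fin N) (Fin N) ℂ)
        else star ((U₀ s.bond : SU N) : Matrix (Fin N) (Fin N) ℂ) * NormedSpace.exp (-(A s.bond))) -
      (if s.fwd then NormedSpace.exp (A s.bond) * (((1 : GaugeField P j (SU N)) s.bond : SU N) : Matrix (Fin N) (Fin N) ℂ)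
        else star (((1 : GaugeField P j (SU N)) s.bond : SU N) : Matrix (Fin N) (Fin N) ℂ) * NormedSpace.exp (-(A s.bond)))‖ ≤ Real.exp ‖A‖ * κ := by
  have hκ0 : 0 ≤ κ := (norm_nonneg _).trans hκ
  have hb : Real.exp ‖A s.bond‖ ≤ Real.exp ‖A‖ := Real.exp_le_exp.2 (norm_le_pi_norm A s.bond)
  have h1 : (((1 : GaugeField P j (SU N)) s.bond : SU N) : Matrix (Fin N) (Fin N) ℂ) = 1 := rfl
  rw [h1, star_one]
  split_ifs
  · have hsplit : NormedSpace.exp (A s.bond) * ((U₀ s.bond : SU N) : Matrix (Fin N) (Fin N) ℂ) - NormedSpace.exp (A s.bond) * 1 =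
        NormedSpace.exp (A s.bond) * (((U₀ s.bond : SU N) : Matrix (Fin N) (Fin N) ℂ) - 1) := by noncomm_ring
    rw [hsplit]
    calc _ ≤ ‖NormedSpace.exp (A s.bond)‖ * ‖((U₀ s.bond : SU N) : Matrix (Fin N) (Fin N) ℂ) - 1‖ := norm_mul_le _ _
      _ ≤ Real.exp ‖A s.bond‖ * κ := mul_le_mul (Literature.Analysis.Complex.norm_exp_le_exp_norm _) hκ (norm_nonneg _) (Real.exp_pos _).le
      _ ≤ Real.exp ‖A‖ * κ := mul_le_mul_of_nonneg_right hb hκ0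
  · have hsplit : star ((U₀ s.bond : SU N) : Matrix (Fin N) (Fin N) ℂ) * NormedSpace.exp (-(A s.bond)) - 1 * NormedSpace.exp (-(A s.bond)) =
        star (((U₀ s.bond : SU N) : Matrix (Fin N) (Fin N) ℂ) - 1) * NormedSpace.exp (-(A s.bond)) := by
      rw [star_sub, star_one]; noncomm_ring
    rw [hsplit]
    calc _ ≤ ‖star (((U₀ s.bond : SU N) : Matrix (Fin N) (Fin N) ℂ) - 1)‖ * ‖NormedSpace.exp (-(A s.bond))‖ := norm_mul_le _ _
      _ ≤ κ * Real.exp ‖A s.bond‖ := by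
          refine mul_le_mul (by rw [norm_star]; exact hκ) ?_ (norm_nonneg _) hκ0
          have h := Literature.Analysis.Complex.norm_exp_le_exp_norm (-(A s.bond)); rwa [norm_neg] at h
      _ ≤ Real.exp ‖A‖ * κ := by rw [mul_comm]; exact mul_le_mul_of_nonneg_right hb hκ0

omit [NeZero N] in
/-- The background step matrix is within `‖U₀(b) − 1‖` of `1` (`‖U⋆ − 1‖ = ‖(U − 1)⋆‖`). [cite: Balaban1985Averaging, (19) p.21 (bookkeeping)] -/
theorem norm_stepM_sub_one_le (s : LStep P j) {κ : ℝ} (hκ : ‖((U₀ s.bond : SU N) : Matrix (Fin N) (Fin N) ℂ) - 1‖ ≤ κ) :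
    ‖stepM (coeField U₀) s - 1‖ ≤ κ := by
  unfold stepM
  split_ifs
  · rw [coeField_apply]; exact hκ
  · rw [coeField_apply, ← star_one (R := Matrix (Fin N) (Fin N) ℂ), ← star_sub, norm_star]; exact hκ

end Steps

/-! ## §3 Walks: the complexified walk products at `U₀` and at `1` differ by `2ℓκ` on the polydisc; the background walk matrices are within `2ℓκ` of `1` -/

section Walks

variable {P : Params} {j : ℕ} {N : ℕ} [NeZero N] (U₀ : GaugeField P j (SU N))

/-- **WALK PRODUCTS AT `U₀` AND AT `1`**: `‖W^{U₀}_A(γ) − W^{1}_A(γ)‖ ≤ |γ|·(e^{‖A‖}κ)·e^{|γ|‖A‖}` when every bond of `γ` carries `‖U₀(b) − 1‖ ≤ κ` (telescoping, §1).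
[cite: Balaban1985Averaging, (19)-(20) p.21 (bookkeeping)] -/
theorem norm_holC_sub_holC_one_le (γ : List (LStep P j)) (A : PBond P j → Matrix (Fin N) (Fin N) ℂ) {κ : ℝ} (hκ0 : 0 ≤ κ)
    (hκ : ∀ s ∈ γ, ‖((U₀ s.bond : SU N) : Matrix (Fin N) (Fin N) ℂ) - 1‖ ≤ κ) :
    ‖(γ.map (fun s : LStep P j => if s.fwd then NormedSpace.exp (A s.bond) * ((U₀ s.bond : SU N) : Matrix (Fin N) (Fin N) ℂ) else star ((U₀ s.bond : SU N) : Matrix (Fin N) (Fin N) ℂ) * NormedSpace.exp (-(A s.bond)))).prod -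
      (γ.map (fun s : LStep P j => if s.fwd then NormedSpace.exp (A s.bond) * (((1 : GaugeField P j (SU N)) s.bond : SU N) : Matrix (Fin N) (Fin N) ℂ) else star (((1 : GaugeField P j (SU N)) s.bond : SU N) : Matrix (Fin N) (Fin N) ℂ) * NormedSpace.exp (-(A s.bond)))).prod‖ ≤
      (γ.length : ℝ) * (Real.exp ‖A‖ * κ) * Real.exp ‖A‖ ^ γ.length :=
  norm_list_map_prod_sub_prod_le γ _ _ (Real.one_le_exp (norm_nonneg A)) (mul_nonneg (Real.exp_pos _).le hκ0)
    (fun s _ => norm_stepC_le U₀ s A) (fun s _ => norm_stepC_le (1 : GaugeField P j (SU N)) s A) (fun s hs => norm_stepC_sub_stepC_one_le U₀ s A (hκ s hs))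

omit [NeZero N] in
/-- On the polydisc `100·ℓ·(e^{‖A‖} − 1) ≤ ρ ≤ 1∕3` the exponential weights of a word of length `≤ ℓ` are harmless: `e^{(|γ|+1)‖A‖} ≤ 2`. [folklore] -/
theorem exp_pow_succ_le_two {a ρ : ℝ} (ha : 0 ≤ a) (hρ3 : ρ ≤ 1 / 3) {m : ℕ} (hm : m ≤ (P.d + 2) * P.L)
    (hA : 100 * ((((P.d + 2) * P.L : ℕ) : ℝ) * (Real.exp a - 1)) ≤ ρ) : Real.exp a ^ (m + 1) ≤ 2 := by
  have hℓ1 : (1 : ℝ) ≤ (((P.d + 2) * P.L : ℕ) : ℝ) := by exact_mod_cast Nat.one_le_iff_ne_zero.2 (Nat.mul_ne_zero (by omega) P.L_pos.ne')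
  have he0 : 0 ≤ Real.exp a - 1 := by linarith [Real.add_one_le_exp a]
  have hm1 : ((m + 1 : ℕ) : ℝ) ≤ 2 * (((P.d + 2) * P.L : ℕ) : ℝ) := by
    have : ((m : ℕ) : ℝ) ≤ (((P.d + 2) * P.L : ℕ) : ℝ) := by exact_mod_cast hm
    rw [Nat.cast_succ]; linarith
  have hcond : ((m + 1 : ℕ) : ℝ) * (Real.exp a - 1) ≤ 1 / 2 := by
    calc ((m + 1 : ℕ) : ℝ) * (Real.exp a - 1) ≤ 2 * (((P.d + 2) * P.L : ℕ) : ℝ) * (Real.exp a - 1) := mul_le_mul_of_nonneg_right hm1 he0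
      _ ≤ 1 / 2 := by nlinarith
  have h := one_add_pow_sub_one_le he0 hcond
  rw [add_sub_cancel] at h
  nlinarith

/-- **NUMERIC FORM**: for a word of length `≤ ℓ` on the polydisc, `‖W^{U₀}_A(γ) − W^{1}_A(γ)‖ ≤ 2·ℓ·κ`. [cite: Balaban1985Averaging, (19)-(20) p.21 (bookkeeping)] -/
theorem norm_holC_sub_holC_one_le_two_mul (γ : List (LStep P j)) (hγ : γ.length ≤ (P.d + 2) * P.L) (A : PBond P j → Matrix (Fin N) (Fin N) ℂ)
    {ρ : ℝ} (hρ3 : ρ ≤ 1 / 3) (hA : 100 * ((((P.d + 2) * P.L : ℕ) : ℝ) * (Real.exp ‖A‖ - 1)) ≤ ρ) {κ : ℝ} (hκ0 : 0 ≤ κ)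
    (hκ : ∀ s ∈ γ, ‖((U₀ s.bond : SU N) : Matrix (Fin N) (Fin N) ℂ) - 1‖ ≤ κ) :
    ‖(γ.map (fun s : LStep P j => if s.fwd then NormedSpace.exp (A s.bond) * ((U₀ s.bond : SU N) : Matrix (Fin N) (Fin N) ℂ) else star ((U₀ s.bond : SU N) : Matrix (Fin N) (Fin N) ℂ) * NormedSpace.exp (-(A s.bond)))).prod -
      (γ.map (fun s : LStep P j => if s.fwd then NormedSpace.exp (A s.bond) * (((1 : GaugeField P j (SU N)) s.bond : SU N) : Matrix (Fin N) (Fin N) ℂ) else star (((1 : GaugeField P j (SU N)) s.bond : SU N) : Matrix (Fin N) (Fin N) ℂ) * NormedSpace.exp (-(A s.bond)))).prod‖ ≤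
      2 * ((((P.d + 2) * P.L : ℕ) : ℝ) * κ) := by
  refine (norm_holC_sub_holC_one_le U₀ γ A hκ0 hκ).trans ?_
  have h2 := exp_pow_succ_le_two (P := P) (norm_nonneg A) hρ3 hγ hA
  have hlen : (γ.length : ℝ) ≤ (((P.d + 2) * P.L : ℕ) : ℝ) := by exact_mod_cast hγ
  have he1 : Real.exp ‖A‖ ^ γ.length * Real.exp ‖A‖ = Real.exp ‖A‖ ^ (γ.length + 1) := by rw [pow_succ]
  calc (γ.length : ℝ) * (Real.exp ‖A‖ * κ) * Real.exp ‖A‖ ^ γ.length = (γ.length : ℝ) * κ * (Real.exp ‖A‖ ^ γ.length * Real.exp ‖A‖) := by ring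
    _ ≤ (((P.d + 2) * P.L : ℕ) : ℝ) * κ * 2 := by
        rw [he1]; exact mul_le_mul (mul_le_mul_of_nonneg_right hlen hκ0) h2 (pow_nonneg (Real.exp_pos _).le _) (by positivity)
    _ = 2 * ((((P.d + 2) * P.L : ℕ) : ℝ) * κ) := by ring

/-- **THE BACKGROUND WALK MATRICES ARE WITHIN `2ℓκ` OF `1`** for a word of length `≤ ℓ` whose bonds carry `‖U₀(b) − 1‖ ≤ κ`, `100ℓκ ≤ ρ ≤ 1∕3` (`(1+κ)^{|γ|} − 1 ≤ 2|γ|κ`).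
[cite: Balaban1985Averaging, (19) p.21 (bookkeeping)] -/
theorem norm_holM_sub_one_le (γ : List (LStep P j)) (hγ : γ.length ≤ (P.d + 2) * P.L) {ρ κ : ℝ} (hρ3 : ρ ≤ 1 / 3) (hκ0 : 0 ≤ κ)
    (hκℓ : 100 * ((((P.d + 2) * P.L : ℕ) : ℝ) * κ) ≤ ρ) (hκ : ∀ s ∈ γ, ‖((U₀ s.bond : SU N) : Matrix (Fin N) (Fin N) ℂ) - 1‖ ≤ κ) :
    ‖holM (coeField U₀) γ - 1‖ ≤ 2 * ((((P.d + 2) * P.L : ℕ) : ℝ) * κ) := by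
  have hlen : (γ.length : ℝ) ≤ (((P.d + 2) * P.L : ℕ) : ℝ) := by exact_mod_cast hγ
  have hcond : (γ.length : ℝ) * κ ≤ 1 / 2 := by nlinarith
  unfold holM
  refine (norm_list_map_prod_sub_one_le γ _ hκ0 fun s hs => norm_stepM_sub_one_le U₀ s (hκ s hs)).trans ?_
  refine (one_add_pow_sub_one_le hκ0 hcond).trans ?_
  nlinarith

end Walks

/-! ## §4 At a coarse bond `c`: the local hypothesis, the background average `‖↑Ū(U₀)(c) − 1‖ ≤ 26ℓκ`, and `‖G^{U₀}_c(A) − G^{1}_c(A)‖ ≤ 60ℓκ`, `‖Φ^{U₀}_c(A) − Φ^{1}_c(A)‖ ≤ 67ℓκ` -/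

section OneStep

variable {P : Params} {j : ℕ} {N : ℕ} [NeZero N] (U₀ : GaugeField P j (SU N))

omit [NeZero N] in
/-- The local hypothesis «`‖U₀(b) − 1‖ ≤ κ` on the bonds issuing from `B(c₋) ∪ B(c₊)`» forces `0 ≤ κ` (the straight segment is nonempty). [folklore] -/
theorem kappa_nonneg_of_local (hj : j + 1 ≤ P.m + P.K) (c : PBond P (j + 1)) {κ : ℝ}
    (hκ : ∀ b : PBond P j, (blockOf b.src = c.src ∨ blockOf b.src = c.tgt) → ‖((U₀ b : SU N) : Matrix (Fin N) (Fin N) ℂ) - 1‖ ≤ κ) : 0 ≤ κ := by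
  have hs : (⟨⟨B10Eq47AxialChi.shiftN (emb c.src) c.dir 0, c.dir⟩, true⟩ : LStep P j) ∈ walk (emb c.src) (List.replicate P.L (c.dir, true)) :=
    (B12B0LoopGeometry267.mem_walk_replicate_true (emb c.src) c.dir P.L _).2 ⟨0, P.L_pos, rfl⟩
  exact (norm_nonneg _).trans (hκ _ (blockOf_src_of_mem_axWalk hj c _ hs))

/-- The loop guard from the local hypothesis: every (0.4) loop variable of `U₀` at `c` is within `2ℓκ` of `1`. [cite: Balaban1985Averaging, (19) p.21] -/
theorem dist1_loopHol_le_of_local (hj : j + 1 ≤ P.m + P.K) (c : PBond P (j + 1)) {ρ κ : ℝ} (hρ3 : ρ ≤ 1 / 3)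
    (hκℓ : 100 * ((((P.d + 2) * P.L : ℕ) : ℝ) * κ) ≤ ρ)
    (hκ : ∀ b : PBond P j, (blockOf b.src = c.src ∨ blockOf b.src = c.tgt) → ‖((U₀ b : SU N) : Matrix (Fin N) (Fin N) ℂ) - 1‖ ≤ κ) (i : Idx P) :
    dist1 (loopHol U₀ c i) ≤ 2 * ((((P.d + 2) * P.L : ℕ) : ℝ) * κ) := by
  show ‖((loopHol U₀ c i : SU N) : Matrix (Fin N) (Fin N) ℂ) - 1‖ ≤ _
  rw [coe_loopHol]
  unfold loopM
  exact norm_holM_sub_one_le U₀ _ ((length_walk _ _).le.trans (length_loopWord_le c i)) hρ3 (kappa_nonneg_of_local U₀ hj c hκ) hκℓ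
    fun s hs => hκ s.bond (blockOf_src_of_mem_walk hj c i s hs)

/-- ★ **THE BACKGROUND AVERAGE IS WITHIN `26ℓκ` OF `1`**: `‖↑Ū(U₀)(c) − 1‖ ≤ 26·ℓ·κ` — `↑Ū(U₀)(c) = eml(loop matrices)·(straight segment)` on the guard (lit `coe_avgFun_of_small`), the loop
tuple and the segment within `2ℓκ` of `1` (§3), `eml` `12`-Lipschitz at `1` (lit `norm_eml_add_sub_eml_le`, `eml_one`). [cite: Balaban1987RG1, (0.4), (0.8) p.253; Balaban1985Averaging, (19)-(21) p.21] -/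
theorem norm_coe_avgFun_sub_one_le (hj : j + 1 ≤ P.m + P.K) (c : PBond P (j + 1)) {ρ κ : ℝ} (hρ : ρ ≤ innerRadius (specialUnitaryLogChart (Fin N)))
    (hκℓ : 100 * ((((P.d + 2) * P.L : ℕ) : ℝ) * κ) ≤ ρ)
    (hκ : ∀ b : PBond P j, (blockOf b.src = c.src ∨ blockOf b.src = c.tgt) → ‖((U₀ b : SU N) : Matrix (Fin N) (Fin N) ℂ) - 1‖ ≤ κ) :
    ‖((avgFun (expMeanLogSU (n := Fin N)) U₀ c : SU N) : Matrix (Fin N) (Fin N) ℂ) - 1‖ ≤ 26 * ((((P.d + 2) * P.L : ℕ) : ℝ) * κ) := by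
  set x : ℝ := (((P.d + 2) * P.L : ℕ) : ℝ) * κ with hx
  have hρ3 : ρ ≤ 1 / 3 := hρ.trans innerRadius_le_third
  have hκ0 : 0 ≤ κ := kappa_nonneg_of_local U₀ hj c hκ
  have hx0 : 0 ≤ x := mul_nonneg (Nat.cast_nonneg _) hκ0
  have hx1 : x ≤ 1 / 300 := by linarith
  -- the guard
  have hguard : ∀ i, dist1 (loopHol U₀ c i) ≤ 2 * x := dist1_loopHol_le_of_local U₀ hj c hρ3 hκℓ hκ
  have hαδ : 2 * x < deltaSU (Fin N) := by linarith [hρ.trans (innerRadius_le_deltaSU (N := N)), deltaSU_pos (n := Fin N)]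
  have hsmall : Small (expMeanLogSU (n := Fin N)) U₀ c := fun i => lt_of_le_of_lt (hguard i) hαδ
  rw [coe_avgFun_of_small U₀ c hsmall]
  unfold avgM corrM axialM
  -- the loop tuple and the straight segment
  have hT : ‖(fun i : Idx P => loopM (coeField U₀) c i) - 1‖ ≤ 2 * x := by
    refine (pi_norm_le_iff_of_nonneg (by positivity)).2 fun i => ?_
    rw [Pi.sub_apply, Pi.one_apply, ← coe_loopHol]
    exact hguard i
  have hS : ‖holM (coeField U₀) (walk (emb c.src) (List.replicate P.L (c.dir, true))) - 1‖ ≤ 2 * x :=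
    norm_holM_sub_one_le U₀ _ (length_walk_replicate_le _ _ _) hρ3 hκ0 hκℓ fun s hs => hκ s.bond (blockOf_src_of_mem_axWalk hj c s hs)
  have hS1 : ‖holM (coeField U₀) (walk (emb c.src) (List.replicate P.L (c.dir, true)))‖ ≤ 1 := norm_holM_coeField_le_one U₀ _
  -- `eml` is `12`-Lipschitz at `1`
  have hE : ‖eml (fun i : Idx P => loopM (coeField U₀) c i) - 1‖ ≤ 12 * (2 * x) := by
    have h := norm_eml_add_sub_eml_le (ι := Idx P) (𝔸 := Matrix (Fin N) (Fin N) ℂ) (U := 1) (V := (fun i : Idx P => loopM (coeField U₀) c i) - 1)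
      (by rw [sub_self, norm_zero]; norm_num) (hT.trans (by linarith))
    rw [add_sub_cancel, eml_one] at h
    exact h.trans (by linarith)
  have hsplit : eml (fun i : Idx P => loopM (coeField U₀) c i) * holM (coeField U₀) (walk (emb c.src) (List.replicate P.L (c.dir, true))) - 1 =
      (eml (fun i : Idx P => loopM (coeField U₀) c i) - 1) * holM (coeField U₀) (walk (emb c.src) (List.replicate P.L (c.dir, true))) +
        (holM (coeField U₀) (walk (emb c.src) (List.replicate P.L (c.dir, true))) - 1) := by noncomm_ring
  rw [hsplit]
  calc _ ≤ ‖eml (fun i : Idx P => loopM (coeField U₀) c i) - 1‖ * ‖holM (coeField U₀) (walk (emb c.src) (List.replicate P.L (c.dir, true)))‖ +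
        ‖holM (coeField U₀) (walk (emb c.src) (List.replicate P.L (c.dir, true))) - 1‖ := (norm_add_le _ _).trans (add_le_add (norm_mul_le _ _) le_rfl)
    _ ≤ 12 * (2 * x) * 1 + 2 * x := add_le_add (mul_le_mul hE hS1 (norm_nonneg _) (by positivity)) hS
    _ = 26 * x := by ring

end OneStep

end Summit.QuantumFields.YangMills.Theorems.FluctuationComparisonRegPrIntLS2BetaChartReadBkgLetters

end
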